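import Summits.HubbardSuperconductivity.HubbardSuperconductivity.Theorems.DeformationLadderLowEnergyRigidityTelescopeRigidity
import Summits.HubbardSuperconductivity.HubbardSuperconductivity.Theorems.TwistGapTgCruxGlue

/-!
# Telescope rigidity, part 4: the crux from the Josephson family and infrared condensation at a point

Route `DeformationLadder`, crux `LowEnergyRigidity` (item stmt-HubbardSuperconductivity-1892), line
`Sketch` (poincare-telescope). Support file (`--supports stmt-HubbardSuperconductivity-1892`).

The strategists' D1 split of the crux is `TgPairMomentumRigidity ∧ TgLowEnergyCondensation ⟹
LowEnergyRigidity` (`TwistGap.lowEnergyRigidity_of_tgCruxes`), with the rigidity child in its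
universal `∀ (U, δ)` form. The glue only ever uses rigidity at the witness point of the condensation
child, so the split has a POINTWISE form (`lowEnergyRigidity_of_rigidityAt_of_condensationAt`: the
bodies of the two TwistGap cruxes at one and the same `(U, δ)` give the crux). Feeding in part 3
(`pairMomentumRigidity_of_josephsonInequalityAt`: the telescope's open input 1 at `(U, δ)` gives the
rigidity body at `(U, δ)`) yields a second kernel-checked composition of the crux from the telescope's
stiffness input: `lowEnergyRigidity_of_josephson_of_condensationAt` — Josephson family at `(U, δ)`
plus infrared condensation of the low-energy window at `(U, δ)` (the body of item
stmt-HubbardSuperconductivity-1510 at the point) give `LowEnergyRigidity` BY NAME. Both inputs are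
conjecture-grade; nothing is claimed about them (CONDITIONAL results). The registered skeleton of the
line (`stub_josephson ∧ stub_floor`, `Cruxes/LowEnergyRigidity/Lines/Sketch.lean`) is unchanged; this
file records the alternative second input for the planners. Linear arithmetic only; no definitions.
[folklore]
-/

noncomputable section

namespace Summit.HubbardSuperconductivity.HubbardSuperconductivity.Theorems.LowEnergyRigidity.Telescope

set_option linter.dupNamespace false -- summit = problem name (single-conjunct summit), D-0017

open Matrix Literature.MathematicalPhysics.QuantumLattice Literature.Probability.LatticeModels
open Summit.HubbardSuperconductivity.HubbardSuperconductivity.Theses.DeformationLadder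
open Summit.HubbardSuperconductivity.HubbardSuperconductivity.Theorems.TwistGap
  (windowSum_eq_zero_add pairMode_zero)

/-- **Pointwise D1 glue.** At a point `0 < U`, `δ ∈ (0, 1/2)`: the body of
`TwistGap.TgPairMomentumRigidity` at `(U, δ)` (pair weight at nonzero infrared momenta costs total
energy, every window `K`, every slack `σ > 0`) and the body of `TwistGap.TgLowEnergyCondensation` at
`(U, δ)` (some window `K`, floor `θ > 0`, energy `Γ > 0`: every unit sector vector within `Γ` of `E₀`
has window weight `≥ θ`) give route DeformationLadder's `LowEnergyRigidity` with
`(κ, a) = (min(Γ, γθ/4), θ/4)` — the proof of `TwistGap.lowEnergyRigidity_of_tgCruxes` verbatim, which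
uses rigidity only at the witness point. CONDITIONAL (both inputs conjecture-grade). [folklore] -/
theorem lowEnergyRigidity_of_rigidityAt_of_condensationAt :
    ∀ (U δ : ℝ), 0 < U → δ ∈ Set.Ioo (0 : ℝ) (1 / 2) →
    (∀ (K : ℕ) (σ : ℝ), 0 < σ → ∃ γ : ℝ, 0 < γ ∧ ∃ L₀ : ℕ, ∀ (L : ℕ) [NeZero L], L₀ ≤ L → Even L →
      ∀ φ : Fock (Orb (FermionTorus 2 L)),
        φ ∈ (szSector (Λ := FermionTorus 2 L) (2 * ⌊(1 - δ) * (L : ℝ) ^ 2 / 2⌋₊) 0) → star φ ⬝ᵥ φ = 1 →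
        γ * ((∑ k ∈ (Finset.univ.filter (fun k : TorusSite 2 L => k ≠ 0 ∧ ∀ i : Fin 2, min (k i).val (L - (k i).val) ≤ K)),
            (expect (Matrix.conjTranspose (∑ x : TorusSite 2 L, Complex.exp (-(2 * (Real.pi : ℂ) * Complex.I / (L : ℂ)) *
                ((∑ i : Fin 2, (k i).val * (x i).val : ℕ) : ℂ)) • localPair dWaveFormFactor L x) *
              (∑ x : TorusSite 2 L, Complex.exp (-(2 * (Real.pi : ℂ) * Complex.I / (L : ℂ)) *
                ((∑ i : Fin 2, (k i).val * (x i).val : ℕ) : ℂ)) • localPair dWaveFormFactor L x)) φ).re / (L : ℝ) ^ 4) - σ) ≤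
          (expect (hubbardTorus 2 L 1 U) φ).re -
            (hubbardTorus 2 L 1 U).minEnergyOn (szSector (Λ := FermionTorus 2 L) (2 * ⌊(1 - δ) * (L : ℝ) ^ 2 / 2⌋₊) 0)) →
    (∃ K : ℕ, ∃ θ : ℝ, 0 < θ ∧ ∃ Γ : ℝ, 0 < Γ ∧ ∃ L₀ : ℕ, ∀ (L : ℕ) [NeZero L], L₀ ≤ L → Even L →
      ∀ φ : Fock (Orb (FermionTorus 2 L)),
        φ ∈ (szSector (Λ := FermionTorus 2 L) (2 * ⌊(1 - δ) * (L : ℝ) ^ 2 / 2⌋₊) 0) → star φ ⬝ᵥ φ = 1 →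
        (expect (hubbardTorus 2 L 1 U) φ).re ≤
          (hubbardTorus 2 L 1 U).minEnergyOn (szSector (Λ := FermionTorus 2 L) (2 * ⌊(1 - δ) * (L : ℝ) ^ 2 / 2⌋₊) 0) + Γ →
        θ ≤ (∑ k ∈ (Finset.univ.filter (fun k : TorusSite 2 L => ∀ i : Fin 2, min (k i).val (L - (k i).val) ≤ K)),
            (expect (Matrix.conjTranspose (∑ x : TorusSite 2 L, Complex.exp (-(2 * (Real.pi : ℂ) * Complex.I / (L : ℂ)) *
                ((∑ i : Fin 2, (k i).val * (x i).val : ℕ) : ℂ)) • localPair dWaveFormFactor L x) *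
              (∑ x : TorusSite 2 L, Complex.exp (-(2 * (Real.pi : ℂ) * Complex.I / (L : ℂ)) *
                ((∑ i : Fin 2, (k i).val * (x i).val : ℕ) : ℂ)) • localPair dWaveFormFactor L x)) φ).re / (L : ℝ) ^ 4)) →
    LowEnergyRigidity := by
  intro U δ hU hδ hR hC
  obtain ⟨K, θ, hθ, Γ, hΓ, L₀, hC⟩ := hC
  obtain ⟨γ, hγ, L₁, hR⟩ := hR K (θ / 2) (by positivity)
  refine ⟨U, hU, δ, hδ, min Γ (γ * (θ / 4)), lt_min hΓ (by positivity), θ / 4, by positivity,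
    max L₀ L₁, fun L _ hL hev φ hmem hφ1 hE => ?_⟩
  -- the two energy windows
  have hmin₁ : min Γ (γ * (θ / 4)) ≤ Γ := min_le_left _ _
  have hmin₂ : min Γ (γ * (θ / 4)) ≤ γ * (θ / 4) := min_le_right _ _
  have hEΓ : (expect (hubbardTorus 2 L 1 U) φ).re ≤
      (hubbardTorus 2 L 1 U).minEnergyOn (szSector (2 * ⌊(1 - δ) * (L : ℝ) ^ 2 / 2⌋₊) 0) + Γ := by
    unfold expect
    linarith
  have hEγ : (expect (hubbardTorus 2 L 1 U) φ).re -
      (hubbardTorus 2 L 1 U).minEnergyOn (szSector (2 * ⌊(1 - δ) * (L : ℝ) ^ 2 / 2⌋₊) 0) ≤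
      γ * (θ / 4) := by
    unfold expect
    linarith
  -- condensation: window weight ≥ θ
  have h1 := hC L (le_of_max_le_left hL) hev φ hmem hφ1 hEΓ
  -- rigidity: off-zero window weight ≤ θ/2 + (⟨H⟩ − E₀)/γ ≤ 3θ/4
  have h2 := hR L (le_of_max_le_right hL) hev φ hmem hφ1
  have h3 := le_of_mul_le_mul_left (h2.trans hEγ) hγ
  -- split the window sum at k = 0 and identify the k = 0 mode with the pair field
  rw [windowSum_eq_zero_add] at h1
  simp only [pairMode_zero] at h1
  linarith

/-- **The crux from the Josephson family and infrared condensation at one point** (second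
kernel-checked composition of the telescope's stiffness input): at `0 < U`, `δ ∈ (0, 1/2)`, the
telescope's open input 1 `JosephsonInequalityAt U δ J C ℓ₁` with `0 < J` and the body of
`TwistGap.TgLowEnergyCondensation` at `(U, δ)` give
`Summit.HubbardSuperconductivity.HubbardSuperconductivity.Theses.DeformationLadder.LowEnergyRigidity`
(part 3 `pairMomentumRigidity_of_josephsonInequalityAt` + the pointwise glue). CONDITIONAL: both
inputs are conjecture-grade (open input 1 of the card poincare-telescope; item
stmt-HubbardSuperconductivity-1510 at the point); nothing is claimed about them here. [folklore] -/
theorem lowEnergyRigidity_of_josephson_of_condensationAt :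
    ∀ (U δ J C : ℝ) (ℓ₁ : ℕ), 0 < U → δ ∈ Set.Ioo (0 : ℝ) (1 / 2) → 0 < J → JosephsonInequalityAt U δ J C ℓ₁ →
    (∃ K : ℕ, ∃ θ : ℝ, 0 < θ ∧ ∃ Γ : ℝ, 0 < Γ ∧ ∃ L₀ : ℕ, ∀ (L : ℕ) [NeZero L], L₀ ≤ L → Even L →
      ∀ φ : Fock (Orb (FermionTorus 2 L)),
        φ ∈ (szSector (Λ := FermionTorus 2 L) (2 * ⌊(1 - δ) * (L : ℝ) ^ 2 / 2⌋₊) 0) → star φ ⬝ᵥ φ = 1 →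
        (expect (hubbardTorus 2 L 1 U) φ).re ≤
          (hubbardTorus 2 L 1 U).minEnergyOn (szSector (Λ := FermionTorus 2 L) (2 * ⌊(1 - δ) * (L : ℝ) ^ 2 / 2⌋₊) 0) + Γ →
        θ ≤ (∑ k ∈ (Finset.univ.filter (fun k : TorusSite 2 L => ∀ i : Fin 2, min (k i).val (L - (k i).val) ≤ K)),
            (expect (Matrix.conjTranspose (∑ x : TorusSite 2 L, Complex.exp (-(2 * (Real.pi : ℂ) * Complex.I / (L : ℂ)) *
                ((∑ i : Fin 2, (k i).val * (x i).val : ℕ) : ℂ)) • localPair dWaveFormFactor L x) *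
              (∑ x : TorusSite 2 L, Complex.exp (-(2 * (Real.pi : ℂ) * Complex.I / (L : ℂ)) *
                ((∑ i : Fin 2, (k i).val * (x i).val : ℕ) : ℂ)) • localPair dWaveFormFactor L x)) φ).re / (L : ℝ) ^ 4)) →
    LowEnergyRigidity :=
  fun U δ J C ℓ₁ hU hδ hJ hJos hC =>
    lowEnergyRigidity_of_rigidityAt_of_condensationAt U δ hU hδ
      (pairMomentumRigidity_of_josephsonInequalityAt U δ J C ℓ₁ hJ hJos) hC

/-- **TwistGap's condensation crux closes the crux modulo the Josephson family** (by name): if the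
telescope's Josephson family holds at every `U > 0`, `δ ∈ (0, 1/2)`, then
`TwistGap.TgLowEnergyCondensation` (item stmt-HubbardSuperconductivity-1510) alone gives
`LowEnergyRigidity`; conversely `LowEnergyRigidity → TgLowEnergyCondensation` is the tree's
`TwistGap.tgLowEnergyCondensation_of_lowEnergyRigidity`. CONDITIONAL (the Josephson family is
conjecture-grade). [folklore] -/
theorem lowEnergyRigidity_of_tgLowEnergyCondensation_of_josephson
    (h : ∀ U : ℝ, 0 < U → ∀ δ ∈ Set.Ioo (0 : ℝ) (1 / 2),
      ∃ J : ℝ, 0 < J ∧ ∃ C : ℝ, ∃ ℓ₁ : ℕ, JosephsonInequalityAt U δ J C ℓ₁)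
    (hC : Summit.HubbardSuperconductivity.HubbardSuperconductivity.Theses.TwistGap.TgLowEnergyCondensation) :
    LowEnergyRigidity := by
  obtain ⟨U, hU, δ, hδ, hCUδ⟩ := hC
  obtain ⟨J, hJ, C, ℓ₁, hJos⟩ := h U hU δ hδ
  exact lowEnergyRigidity_of_josephson_of_condensationAt U δ J C ℓ₁ hU hδ hJ hJos hCUδ

end Summit.HubbardSuperconductivity.HubbardSuperconductivity.Theorems.LowEnergyRigidity.Telescope
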